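import Mathlib.FieldTheory.IsAlgClosed.AlgebraicClosure
import Literature.AnabelianGeometry.SemiGraphs.TemperedSpecialFibre
import Literature.AnabelianGeometry.SemiGraphs.Prop36HypothesesWitnessAffChart
import Literature.AnabelianGeometry.AbsoluteAnabelian.SlimTransport
import HarnessLib

/-!
# Non-vacuity of the special-fibre interface `SpecialFibreData` ([SemiAnbd] Example 3.10, p. 44)

Mochizuki, *Semi-graphs of anabelioids*, Publ. RIMS **42** (2006), §3, Example 3.10, manuscript p. 44
[cite: MochizukiSemiAnbd2006, Ex 3.10 p.44]: "`G` (respectively, `G^c`) the graph of anabelioids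
(respectively, semi-graph of anabelioids) … associated to the geometric special fiber of the stable
model of `X^log_K`", with "the natural quotient `Δ ↠ π₁^temp(G) ≅ π₁^temp(G^c)`" (pp. 45, 48) — typed in
`TemperedSpecialFibre.lean` (seat abc-iut-L3-t2) as the INTERFACE structure `SpecialFibreData D` over
`D : TemperedArithmeticGroup K` (fields `Gc`, `hyp : Gc.Thm37Hypotheses`, `chart : TemperedPiChart Gc`,
`admissible : Δ →ₜ* chart.G`, `admissible_surjective`).

PROOF-ONLY file (abc-iut cell §4(iii) non-vacuity lane, row NV-L3/SpecialFibreData; seat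
abc-iut-L3-t2 gen 3, the structure's typer; no definition, no named fact): the field set of
`SpecialFibreData` is JOINTLY SATISFIABLE, with a NON-trivial tempered side.  The inhabitant:
* [SemiAnbd] side — GENUINE: `G^c :=` the one-vertex, edgeless semi-graph of anabelioids with vertex
  group `Aff(ℤ_p) = ℤ_p ⋊ ℤ_p^×` (`affWitness p`, seat abc-iut-w5-d212: it satisfies the hypotheses of
  Thm. 3.7), its explicit tempered fundamental group chart `affChart p` with `π₁^temp(G^c) = Aff(ℤ_p)`
  (seat abc-iut-w5-d236; the identity `Aff(ℤ_p) → π₁^temp(G^c)` IS a verticial homomorphism,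
  `isVerticialHom_id_affChart`), and `admissible :=` the identity of `Δ = Aff(ℤ_p)`, surjective;
* arithmetic side — DEGENERATE, as in seat abc-iut-c312-4's `TemperedCurvesWitness.lean`: `K`
  algebraically closed, so `G_K = Gal(K̄/K) = 1`, `Π := Δ := Aff(ℤ_p)` (profinite, hence tempered,
  [SemiAnbd] Rmk. 3.1.1; slim; second countable) with the trivial augmentation.
HONEST LIMITS: consistency evidence only — nothing here is the special fibre of a curve, nothing is said
about `K/ℚ_p` finite (the intended case needs André's `π₁^temp`, not in the tree), and the origin
certificate `SpecialFibreOrigin.IsSpecialFibreOf` is NOT claimed for this datum.  No statement of the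
paper is asserted; nothing here bears on [IUTchIII] Cor. 3.12.
-/

noncomputable section

namespace Literature.AnabelianGeometry.SemiGraphs

open Literature.AlgebraicGeometry.Frobenioids (IsSlimGroup)
open Literature.GroupTheory.SpecificGroups
open ProfiniteSemiGraph Topology

/-- Over an algebraically closed field the absolute Galois group `Gal(K̄/K)` is trivial (every
`K`-automorphism of `K̄` is the identity, `K → K̄` being surjective). [folklore] -/
private theorem subsingleton_absoluteGaloisGroup' (K : Type) [Field K] [IsAlgClosed K] :
    Subsingleton (Field.absoluteGaloisGroup K) := by
  refine ⟨fun σ τ => AlgEquiv.ext fun x => ?_⟩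
  obtain ⟨k, rfl⟩ :=
    (IsAlgClosed.algebraMap_bijective_of_isIntegral (k := K) (K := AlgebraicClosure K)).2 x
  rw [AlgEquiv.commutes, AlgEquiv.commutes]

/-- A closed subgroup of the profinite group `Aff(ℤ_p)` is tempered (it is profinite: [SemiAnbd]
Rmk. 3.1.1 "every profinite group is tempered", the tree's `IsTempered.of_profinite`).
[cite: MochizukiSemiAnbd2006, Rmk 3.1.1 p.33] -/
private theorem isTempered_subgroup_padicAffine (p : ℕ) [Fact p.Prime] (H : Subgroup (PadicAffine p))
    (hH : IsClosed (H : Set (PadicAffine p))) : IsTempered H := by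
  haveI : CompactSpace H := isCompact_iff_compactSpace.mp hH.isCompact
  exact IsTempered.of_profinite

section WithPrime

variable (p : ℕ) [Fact p.Prime]

/-- The kernel of the trivial augmentation `Aff(ℤ_p) → G_K` is everything. [folklore] -/
private theorem ker_one_eq_top (K : Type) [Field K] :
    (1 : PadicAffine p →ₜ* Field.absoluteGaloisGroup K).toMonoidHom.ker = ⊤ := by
  ext g
  simp only [MonoidHom.mem_ker, Subgroup.mem_top, iff_true]
  rfl

/-- Slimness of the kernel `Δ = ⊤ ≃ₜ* Aff(ℤ_p)` of the trivial augmentation (transport of the tree's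
`PadicAffine.centralizer_eq_bot_of_isOpen` along `Subgroup.topEquiv`). [folklore] -/
private theorem isSlimGroup_ker_one (K : Type) [Field K] :
    IsSlimGroup (1 : PadicAffine p →ₜ* Field.absoluteGaloisGroup K).toMonoidHom.ker := by
  rw [ker_one_eq_top]
  have e : (⊤ : Subgroup (PadicAffine p)) ≃ₜ* PadicAffine p :=
    { Subgroup.topEquiv with
      continuous_toFun := continuous_subtype_val
      continuous_invFun := Continuous.subtype_mk continuous_id _ }
  exact (Literature.AnabelianGeometry.AbsoluteAnabelian.isSlimGroup_congr e).2
    ⟨PadicAffine.centralizer_eq_bot_of_isOpen⟩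

/-- Temperedness of the kernel of the trivial augmentation (a closed subgroup of a profinite group).
[cite: MochizukiSemiAnbd2006, Rmk 3.1.1 p.33] -/
private theorem isTempered_ker_one (K : Type) [Field K] :
    IsTempered (1 : PadicAffine p →ₜ* Field.absoluteGaloisGroup K).toMonoidHom.ker :=
  isTempered_subgroup_padicAffine p _ (by rw [ker_one_eq_top]; exact isClosed_univ)

/-- **A tempered arithmetic group with `Π = Aff(ℤ_p)`** ([SemiAnbd] Ex. 3.10 as typed, inhabited) for `K`
algebraically closed: the trivial augmentation onto `G_K = 1` (so `Δ = Π`); tempered and slim on both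
`Π` and `Δ`, Galois-countable.  (Compare seat abc-iut-c312-4's trivial inhabitant
`TemperedArithmeticGroup.nonempty_of_isAlgClosed`; here the tempered group is the non-trivial profinite
`Aff(ℤ_p)`, so that a semi-graph of anabelioids can be attached to it below.)  DEGENERATE on the
arithmetic side by design. [cite: MochizukiSemiAnbd2006, Ex 3.10 pp.43-45] -/
theorem TemperedArithmeticGroup.exists_continuousMulEquiv_padicAffine_of_isAlgClosed (K : Type) [Field K]
    [IsAlgClosed K] : ∃ D : TemperedArithmeticGroup K, Nonempty (D.Pi ≃ₜ* PadicAffine p) := by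
  haveI := subsingleton_absoluteGaloisGroup' K
  exact ⟨{ Pi := PadicAffine p
           isTempered := isTempered_padicAffine
           aug := 1
           aug_surjective := fun g => ⟨1, Subsingleton.elim _ _⟩
           isTempered_ker := isTempered_ker_one p K
           isSlimGroup := ⟨PadicAffine.centralizer_eq_bot_of_isOpen⟩
           isSlimGroup_ker := isSlimGroup_ker_one p K
           secondCountableTopology := secondCountableTopology_padicAffine },
    ⟨ContinuousMulEquiv.refl _⟩⟩

end WithPrime

/-- **NON-VACUITY of `SpecialFibreData`** ([SemiAnbd] Ex. 3.10 p. 44 as typed): for `K` algebraically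
closed there is a tempered arithmetic group `D` (`Π = Δ = Aff(ℤ_p)` with the trivial augmentation —
DEGENERATE arithmetic side) carrying special-fibre data whose [SemiAnbd] side is GENUINE — `G^c` the
one-vertex edgeless semi-graph of anabelioids with `Π_v = Aff(ℤ_p)` satisfying the hypotheses of Thm. 3.7
(`affWitness p`), its explicit chart `π₁^temp(G^c) = Aff(ℤ_p)` (`affChart p`), and the admissible quotient
`Δ ↠ π₁^temp(G^c)` the inclusion `Δ = ⊤ ↪ Aff(ℤ_p)`, i.e. the identity — a verticial homomorphism
(`isVerticialHom_id_affChart`), surjective.  Consistency evidence only; the origin certificate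
`SpecialFibreOrigin.IsSpecialFibreOf` is not claimed. [cite: MochizukiSemiAnbd2006, Ex 3.10 p.44] -/
theorem exists_temperedArithmeticGroup_specialFibreData_of_isAlgClosed (p : ℕ) [Fact p.Prime]
    (K : Type) [Field K] [IsAlgClosed K] :
    ∃ D : TemperedArithmeticGroup K, Nonempty (SpecialFibreData D) := by
  haveI := subsingleton_absoluteGaloisGroup' K
  let D : TemperedArithmeticGroup K :=
    { Pi := PadicAffine p
      isTempered := isTempered_padicAffine
      aug := 1
      aug_surjective := fun g => ⟨1, Subsingleton.elim _ _⟩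
      isTempered_ker := isTempered_ker_one p K
      isSlimGroup := ⟨PadicAffine.centralizer_eq_bot_of_isOpen⟩
      isSlimGroup_ker := isSlimGroup_ker_one p K
      secondCountableTopology := secondCountableTopology_padicAffine }
  have hdelta : D.delta = ⊤ := ker_one_eq_top p K
  refine ⟨D, ⟨{ Gc := affWitness p
                hyp := affWitness_thm37Hypotheses
                chart := affChart p
                admissible := ⟨D.delta.subtype, continuous_subtype_val⟩
                admissible_surjective := fun g => ⟨⟨g, hdelta ▸ Subgroup.mem_top g⟩, rfl⟩ }⟩⟩

/-- The same in `Nonempty` form over the Σ-type (for census tools that look for a `Nonempty` producer).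
[cite: MochizukiSemiAnbd2006, Ex 3.10 p.44] -/
theorem nonempty_sigma_specialFibreData_of_isAlgClosed (K : Type) [Field K] [IsAlgClosed K] :
    Nonempty (Σ D : TemperedArithmeticGroup K, SpecialFibreData D) := by
  haveI : Fact (Nat.Prime 2) := ⟨Nat.prime_two⟩
  obtain ⟨D, ⟨S⟩⟩ := exists_temperedArithmeticGroup_specialFibreData_of_isAlgClosed 2 K
  exact ⟨⟨D, S⟩⟩

end Literature.AnabelianGeometry.SemiGraphs

end
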